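import Mathlib
import HarnessLib
import Summits.AtomisticToContinuum.FouriersLaw.Theses.JunctionLocality
import Summits.AtomisticToContinuum.FouriersLaw.Theorems.JunctionLocalityConductanceLowerBoundStubFisherSquare
import Summits.AtomisticToContinuum.FouriersLaw.Theorems.JunctionLocalitySuperadditiveResistanceKuboGauss
import Summits.AtomisticToContinuum.FouriersLaw.Theorems.JunctionLocalitySuperadditiveResistancePlainAdjoint
import Summits.AtomisticToContinuum.FouriersLaw.Theorems.JunctionLocalitySuperadditiveResistanceKuboReversal
import Literature.MathematicalPhysics.KineticTheory.LangevinChainSDE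

/-!
# Certificate pairing identities for the transmission-gradient floor, II: pairing with the source
(crux stmt-AtomisticToContinuum-11749, line `ForecastSensitivitySketch`)

Helper file (`--supports stmt-AtomisticToContinuum-11749`, lead c5).  Setting as in part I (`…CertificatePairingEnergy`):
`pinnedChain ω₂ lam β γ` (`ω₂ > 0`, `lam, β ≥ 0`), `T > 0`, `L ≥ 2`, `μ_T = gibbsMeasure L T`, `S_B = bathOp L (bathWeight L) T`,
`X_H = liouvilleOp`; an ADMISSIBLE PAIR `(φ, χ)` satisfies `γ S_B φ + X_H χ = −(p_0² − T)` pointwise.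

* `liouvilleOp_sq_sub` — `X_H (p_i² − c) = −2 p_i ∂_{q_i} H` (kinetic-energy production);
* `memLp_momentum_mul_partialQ_hamiltonian` — `p_i ∂_{q_i} H ∈ L²(μ_T)`;
* `certificate_pairing_source` — pairing the constraint with the source `p_0² − T`:
  `γ T ⟨p_0, ∂_{p_0} φ⟩_{μ_T} − ⟨χ, p_0 ∂_{q_0} H⟩_{μ_T} = T²`
  (multiply by `χ_n (p_0² − T)`, `∂_{p_0}(p_0² − T) = 2p_0`, `∫ (p_0² − T)² dμ_T = 2T²`, `n → ∞`).

Together with part I (`γ(⟨p_0,∂_{p_0}φ⟩ + ⟨p_{L−1},∂_{p_{L−1}}φ⟩) = T`) this gives the loading reciprocity and the two-ends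
obstruction of `…CertificateObstruction`.  No new definitions, no named facts, no sorry.  References: folklore (Gaussian
integration by parts against `e^{−H/T}`); Bernardin–Olla 2011 §6 for the variational context.
-/

noncomputable section

open MeasureTheory Filter Topology
open scoped ContDiff
open Literature.MathematicalPhysics.KineticTheory.HeatConduction
open Summit.AtomisticToContinuum.FouriersLaw.Theorems.SuperadditiveResistance.DeviceLiouville
  (kin kin_eq_sq continuous_kin liouvilleOp bathOp continuous_liouvilleOp continuous_bathOp
    pinnedChain_sq_le_two_mul_hamiltonian)
open Summit.AtomisticToContinuum.FouriersLaw.Theorems.SuperadditiveResistance.Kubo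
  (chi contDiff_chi hasCompactSupport_chi tendsto_integral_chi_mul tendsto_integral_partialP_chi_mul
    integral_chi_mul_bathOp integral_chi_liouville_antisymm
    integrable_mul_mul_gibbsDensity integrable_sq_mul_gibbsDensity memLp_momentum memLp_kinetic memLp_hamiltonian
    integral_kinetic_mul_hamiltonian_mul_gibbsDensity gauss_ibp integral_sq_mul_gibbsDensity_eq
    partialQ_hamiltonian_rev integral_rev_mul_gibbsDensity rev)
open Summit.AtomisticToContinuum.FouriersLaw.Cruxes.SuperadditiveResistance.InsertionToolbox
  (pinnedChain_memLp_two_of_abs_le)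

namespace Summit.AtomisticToContinuum.FouriersLaw.Cruxes.ConductanceLowerBound.ForecastSensitivity

variable {ω₂ lam β γ T : ℝ}


/-! ## §2 Pairing the constraint with the source `p_0² − T` -/

section SourceCalculus

variable {L : ℕ}

/-- `∂_{p_i} (p_i² − c) = 2 p_i`. [folklore] -/
theorem partialP_sq_sub_self (i : Fin L) (c : ℝ) (x : PhaseSpace L) :
    partialP i (fun y : PhaseSpace L => y.2 i ^ 2 - c) x = 2 * x.2 i := by
  simp only [partialP, Function.update_self]
  have h : deriv (fun t : ℝ => t ^ 2 - c) (x.2 i) = 2 * x.2 i := by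
    rw [((hasDerivAt_pow 2 (x.2 i)).sub_const c).deriv]
    ring
  exact h

/-- `∂_{p_j} (p_i² − c) = 0` for `j ≠ i`. [folklore] -/
theorem partialP_sq_sub_of_ne {i j : Fin L} (h : j ≠ i) (c : ℝ) (x : PhaseSpace L) :
    partialP j (fun y : PhaseSpace L => y.2 i ^ 2 - c) x = 0 := by
  simp only [partialP, Function.update_of_ne h.symm, deriv_const]

/-- `∂_{q_j} (p_i² − c) = 0`. [folklore] -/
theorem partialQ_sq_sub (i j : Fin L) (c : ℝ) (x : PhaseSpace L) :
    partialQ j (fun y : PhaseSpace L => y.2 i ^ 2 - c) x = 0 := by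
  simp only [partialQ, deriv_const]

/-- `X_H (p_i² − c) = −2 p_i ∂_{q_i} H` (the kinetic-energy production at site `i`). [folklore] -/
theorem liouvilleOp_sq_sub (P : OscillatorChain) (i : Fin L) (c : ℝ) (x : PhaseSpace L) :
    liouvilleOp P L (fun y : PhaseSpace L => y.2 i ^ 2 - c) x =
      -(2 * x.2 i * partialQ i (P.hamiltonian L) x) := by
  unfold liouvilleOp
  simp only [partialQ_sq_sub, mul_zero, zero_sub]
  rw [Finset.sum_eq_single_of_mem i (Finset.mem_univ _)]
  · rw [partialP_sq_sub_self]; ring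
  · intro j _ hj
    rw [partialP_sq_sub_of_ne hj]; ring

end SourceCalculus

/-- `p_i ∂_{q_i} H ∈ L²(μ_T)` for the pinned chain: `|p_i| ≤ 1 + H`, `|∂_{q_i}H| ≤ C_L (1 + H)`. [folklore] -/
theorem memLp_momentum_mul_partialQ_hamiltonian (hω : 0 < ω₂) (hl : 0 ≤ lam) (hβ : 0 ≤ β) (hT : 0 < T)
    (L : ℕ) (i : Fin L) :
    MemLp (fun x : PhaseSpace L => x.2 i * partialQ i ((pinnedChain ω₂ lam β γ).hamiltonian L) x) 2 ((pinnedChain ω₂ lam β γ).gibbsMeasure L T) := by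
  have hU := pinnedChain_contDiff_U ω₂ lam β γ (n := ∞)
  have hV := pinnedChain_contDiff_V ω₂ lam β γ (n := ∞)
  have hH1 : ContDiff ℝ 1 ((pinnedChain ω₂ lam β γ).hamiltonian L) := ((pinnedChain ω₂ lam β γ).contDiff_hamiltonian hU hV L).of_le (by norm_cast)
  have hc : Continuous (fun x : PhaseSpace L => x.2 i * partialQ i ((pinnedChain ω₂ lam β γ).hamiltonian L) x) :=
    (continuous_apply i |>.comp continuous_snd).mul ((pinnedChain ω₂ lam β γ).continuous_partialQ_hamiltonian hH1 i)
  set C : ℝ := L * (ω₂ / 2 + 3 + lam / ω₂ + L ^ 2 * (3 + β)) with hC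
  have hC0 : 0 ≤ C := by
    have : 0 ≤ lam / ω₂ := div_nonneg hl hω.le
    positivity
  refine pinnedChain_memLp_two_of_abs_le hω hl hβ γ L hT hc (C := C) (k := 2) fun x => ?_
  have hH0 : 0 ≤ (pinnedChain ω₂ lam β γ).hamiltonian L x := pinnedChain_hamiltonian_nonneg hω.le hl hβ γ L x
  have hp : |x.2 i| ≤ 1 + (pinnedChain ω₂ lam β γ).hamiltonian L x := by
    have h2 := pinnedChain_sq_le_two_mul_hamiltonian hω.le hl hβ γ L x i
    have : |x.2 i| ≤ (1 + x.2 i ^ 2) / 2 := by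
      rw [abs_le]; constructor <;> nlinarith [sq_nonneg (x.2 i - 1), sq_nonneg (x.2 i + 1)]
    linarith
  have hq : |partialQ i ((pinnedChain ω₂ lam β γ).hamiltonian L) x| ≤ C * (1 + (pinnedChain ω₂ lam β γ).hamiltonian L x) :=
    (Finset.single_le_sum (f := fun j => |partialQ j ((pinnedChain ω₂ lam β γ).hamiltonian L) x|)
      (fun _ _ => abs_nonneg _) (Finset.mem_univ i)).trans (pinnedChain_sum_abs_partialQ_le hω hl hβ γ L x)
  rw [abs_mul]
  calc |x.2 i| * |partialQ i ((pinnedChain ω₂ lam β γ).hamiltonian L) x|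
      ≤ (1 + (pinnedChain ω₂ lam β γ).hamiltonian L x) * (C * (1 + (pinnedChain ω₂ lam β γ).hamiltonian L x)) :=
        mul_le_mul hp hq (abs_nonneg _) (by linarith)
    _ = C * (1 + (pinnedChain ω₂ lam β γ).hamiltonian L x) ^ 2 := by ring

/-- **Pairing identity with the source (Lebesgue form).**  For an admissible pair `(φ, χ)` of the `L`-chain
(`L ≥ 2`) with `χ ∈ L²(μ_T)`:
`γ T ∫ p_0 ∂_{p_0}φ e^{−H/T} − ∫ χ · p_0 ∂_{q_0}H e^{−H/T} = T² ∫ e^{−H/T}`.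
Proof: multiply the constraint by `χ_n (p_0² − T)` and integrate; `X_H (p_0² − T) = −2 p_0 ∂_{q_0}H`,
`∂_{p_0}(p_0² − T) = 2 p_0`, `∫ (p_0² − T)² ρ = 2T² ∫ ρ`; let `n → ∞`. [folklore] -/
theorem certificate_pairing_source_density (hω : 0 < ω₂) (hl : 0 ≤ lam) (hβ : 0 ≤ β) (hT : 0 < T)
    {L : ℕ} (hL : 2 ≤ L) {φ χ : PhaseSpace L → ℝ} (hφ : ContDiff ℝ 2 φ) (hχ : ContDiff ℝ 2 χ)
    (hφ0 : MemLp (partialP (⟨0, by omega⟩ : Fin L) φ) 2 ((pinnedChain ω₂ lam β γ).gibbsMeasure L T))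
    (hφR : MemLp (partialP (⟨L - 1, by omega⟩ : Fin L) φ) 2 ((pinnedChain ω₂ lam β γ).gibbsMeasure L T))
    (hχ2 : MemLp χ 2 ((pinnedChain ω₂ lam β γ).gibbsMeasure L T))
    (hpair : ∀ x, γ * bathOp L (OscillatorChain.bathWeight L) T φ x +
      liouvilleOp (pinnedChain ω₂ lam β γ) L χ x = -(kin L 0 x - T)) :
    γ * T * (∫ x, x.2 ⟨0, by omega⟩ * partialP (⟨0, by omega⟩ : Fin L) φ x * (pinnedChain ω₂ lam β γ).gibbsDensity L T x) -
      ∫ x, χ x * (x.2 ⟨0, by omega⟩ * partialQ (⟨0, by omega⟩ : Fin L) ((pinnedChain ω₂ lam β γ).hamiltonian L) x) *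
        (pinnedChain ω₂ lam β γ).gibbsDensity L T x =
      T ^ 2 * ∫ x, (pinnedChain ω₂ lam β γ).gibbsDensity L T x := by
  have hL0 : 0 < L := by omega
  have hL1 : L - 1 < L := by omega
  set B := OscillatorChain.bathWeight L with hB
  set i0 : Fin L := ⟨0, hL0⟩ with hi0
  set iR : Fin L := ⟨L - 1, hL1⟩ with hiR
  have hne : iR ≠ i0 := by
    intro h
    have := congrArg Fin.val h
    simp only [hiR, hi0] at this
    omega
  have hTne : T ≠ 0 := hT.ne'
  -- the source and the kinetic power
  set u : PhaseSpace L → ℝ := fun y => y.2 i0 ^ 2 - T with hu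
  set W : PhaseSpace L → ℝ := fun y => y.2 i0 * partialQ i0 ((pinnedChain ω₂ lam β γ).hamiltonian L) y with hW
  have hku : ∀ x, kin L 0 x - T = u x := fun x => by simp only [hu, kin_eq_sq hL0]; rfl
  have hu2 : ContDiff ℝ 2 u := by simp only [hu]; fun_prop
  have hu1 : ContDiff ℝ 1 u := hu2.of_le (by norm_cast)
  have huc : Continuous u := hu2.continuous
  have hdu0 : ∀ x, partialP i0 u x = 2 * x.2 i0 := fun x => partialP_sq_sub_self i0 T x
  have hduR : ∀ x, partialP iR u x = 0 := fun x => partialP_sq_sub_of_ne hne T x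
  have hXu : ∀ x, liouvilleOp (pinnedChain ω₂ lam β γ) L u x = -(2 * W x) := fun x => by
    have h := liouvilleOp_sq_sub (pinnedChain ω₂ lam β γ) i0 T x
    simp only [hu, hW]
    rw [h]
    ring
  have hU := pinnedChain_contDiff_U ω₂ lam β γ (n := ∞)
  have hV := pinnedChain_contDiff_V ω₂ lam β γ (n := ∞)
  have hHs : ContDiff ℝ ∞ ((pinnedChain ω₂ lam β γ).hamiltonian L) := (pinnedChain ω₂ lam β γ).contDiff_hamiltonian hU hV L
  have hH1 : ContDiff ℝ 1 ((pinnedChain ω₂ lam β γ).hamiltonian L) := hHs.of_le (by norm_cast)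
  have hρc : Continuous ((pinnedChain ω₂ lam β γ).gibbsDensity L T) := pinnedChain_continuous_gibbsDensity ω₂ lam β γ L T
  have hφ1 : ContDiff ℝ 1 φ := hφ.of_le (by norm_cast)
  have hχ1 : ContDiff ℝ 1 χ := hχ.of_le (by norm_cast)
  have hχc : Continuous χ := hχ.continuous
  have hdφc : ∀ i, Continuous (partialP i φ) := fun i => continuous_partialP hφ1 one_ne_zero i
  have hWc : Continuous W :=
    (continuous_apply i0 |>.comp continuous_snd).mul ((pinnedChain ω₂ lam β γ).continuous_partialQ_hamiltonian hH1 i0)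
  have hχs : ∀ n, ContDiff ℝ ∞ (chi (pinnedChain ω₂ lam β γ) L n) := fun n => contDiff_chi hHs n
  have hχnc : ∀ n, Continuous (chi (pinnedChain ω₂ lam β γ) L n) := fun n => (hχs n).continuous
  have hχncs : ∀ n, HasCompactSupport (chi (pinnedChain ω₂ lam β γ) L n) := fun n => hasCompactSupport_chi hω hl hβ γ L n
  have hdχnc : ∀ n i, Continuous (partialP i (chi (pinnedChain ω₂ lam β γ) L n)) := fun n i =>
    continuous_partialP ((hχs n).of_le (by norm_cast)) one_ne_zero i
  have hXχc : Continuous (liouvilleOp (pinnedChain ω₂ lam β γ) L χ) :=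
    continuous_liouvilleOp (pinnedChain ω₂ lam β γ) (hU.of_le (by norm_cast)) (hV.of_le (by norm_cast)) hχ1
  have hSφc : Continuous (bathOp L B T φ) := continuous_bathOp hφ B T
  -- the identity at cutoff level n
  have hlevel : ∀ n : ℕ,
      γ * (-T * ∑ i, B i * ((∫ x, chi (pinnedChain ω₂ lam β γ) L n x * partialP i u x * partialP i φ x * (pinnedChain ω₂ lam β γ).gibbsDensity L T x) +
        ∫ x, u x * partialP i (chi (pinnedChain ω₂ lam β γ) L n) x * partialP i φ x * (pinnedChain ω₂ lam β γ).gibbsDensity L T x)) +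
        2 * ∫ x, chi (pinnedChain ω₂ lam β γ) L n x * χ x * W x * (pinnedChain ω₂ lam β γ).gibbsDensity L T x =
      -∫ x, chi (pinnedChain ω₂ lam β γ) L n x * u x * u x * (pinnedChain ω₂ lam β γ).gibbsDensity L T x := by
    intro n
    have hbath := integral_chi_mul_bathOp hω hl hβ γ L B hTne hu2 hφ n
    have hanti := integral_chi_liouville_antisymm hω hl hβ γ L hTne hu2 hχ n
    -- ∫ χ_n u X_Hχ ρ = 2 ∫ χ_n χ W ρ
    have hIW : Integrable fun x => chi (pinnedChain ω₂ lam β γ) L n x * χ x * W x * (pinnedChain ω₂ lam β γ).gibbsDensity L T x :=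
      Continuous.integrable_of_hasCompactSupport (by fun_prop) (((hχncs n).mul_right).mul_right.mul_right)
    have hX : ∫ x, chi (pinnedChain ω₂ lam β γ) L n x * u x * liouvilleOp (pinnedChain ω₂ lam β γ) L χ x * (pinnedChain ω₂ lam β γ).gibbsDensity L T x =
        2 * ∫ x, chi (pinnedChain ω₂ lam β γ) L n x * χ x * W x * (pinnedChain ω₂ lam β γ).gibbsDensity L T x := by
      have hI2 : Integrable fun x => chi (pinnedChain ω₂ lam β γ) L n x * u x * liouvilleOp (pinnedChain ω₂ lam β γ) L χ x * (pinnedChain ω₂ lam β γ).gibbsDensity L T x :=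
        Continuous.integrable_of_hasCompactSupport (by fun_prop) (((hχncs n).mul_right).mul_right.mul_right)
      have h2 : (∫ x, chi (pinnedChain ω₂ lam β γ) L n x * u x * liouvilleOp (pinnedChain ω₂ lam β γ) L χ x * (pinnedChain ω₂ lam β γ).gibbsDensity L T x) -
          2 * ∫ x, chi (pinnedChain ω₂ lam β γ) L n x * χ x * W x * (pinnedChain ω₂ lam β γ).gibbsDensity L T x = 0 := by
        rw [← integral_const_mul, ← integral_sub hI2 (hIW.const_mul 2), ← hanti]
        refine integral_congr_ae (ae_of_all _ fun x => ?_)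
        dsimp only
        rw [hXu x]
        ring
      linarith
    -- integrate the constraint against χ_n u ρ
    have hI1 : Integrable fun x => chi (pinnedChain ω₂ lam β γ) L n x * u x * bathOp L B T φ x * (pinnedChain ω₂ lam β γ).gibbsDensity L T x :=
      Continuous.integrable_of_hasCompactSupport (by fun_prop) (((hχncs n).mul_right).mul_right.mul_right)
    have hI2 : Integrable fun x => chi (pinnedChain ω₂ lam β γ) L n x * u x * liouvilleOp (pinnedChain ω₂ lam β γ) L χ x * (pinnedChain ω₂ lam β γ).gibbsDensity L T x :=
      Continuous.integrable_of_hasCompactSupport (by fun_prop) (((hχncs n).mul_right).mul_right.mul_right)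
    have hsum : γ * (∫ x, chi (pinnedChain ω₂ lam β γ) L n x * u x * bathOp L B T φ x * (pinnedChain ω₂ lam β γ).gibbsDensity L T x) +
        ∫ x, chi (pinnedChain ω₂ lam β γ) L n x * u x * liouvilleOp (pinnedChain ω₂ lam β γ) L χ x * (pinnedChain ω₂ lam β γ).gibbsDensity L T x =
        -∫ x, chi (pinnedChain ω₂ lam β γ) L n x * u x * u x * (pinnedChain ω₂ lam β γ).gibbsDensity L T x := by
      rw [← integral_const_mul, ← integral_add (hI1.const_mul γ) hI2, ← integral_neg]
      refine integral_congr_ae (ae_of_all _ fun x => ?_)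
      have := hpair x
      rw [hku x] at this
      calc γ * (chi (pinnedChain ω₂ lam β γ) L n x * u x * bathOp L B T φ x * (pinnedChain ω₂ lam β γ).gibbsDensity L T x) +
          chi (pinnedChain ω₂ lam β γ) L n x * u x * liouvilleOp (pinnedChain ω₂ lam β γ) L χ x * (pinnedChain ω₂ lam β γ).gibbsDensity L T x
          = chi (pinnedChain ω₂ lam β γ) L n x * u x * (γ * bathOp L B T φ x + liouvilleOp (pinnedChain ω₂ lam β γ) L χ x) * (pinnedChain ω₂ lam β γ).gibbsDensity L T x := by
            ring
        _ = chi (pinnedChain ω₂ lam β γ) L n x * u x * (-u x) * (pinnedChain ω₂ lam β γ).gibbsDensity L T x := by rw [this]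
        _ = -(chi (pinnedChain ω₂ lam β γ) L n x * u x * u x * (pinnedChain ω₂ lam β γ).gibbsDensity L T x) := by ring
    rw [hX, hbath] at hsum
    exact hsum
  -- the two contact terms, with `∂_{p_0} u = 2 p_0`, `∂_{p_{L−1}} u = 0`
  have hlevel' : ∀ n : ℕ,
      -(γ * T) * (((∫ x, chi (pinnedChain ω₂ lam β γ) L n x * (2 * x.2 i0) * partialP i0 φ x * (pinnedChain ω₂ lam β γ).gibbsDensity L T x) +
          ∫ x, u x * partialP i0 (chi (pinnedChain ω₂ lam β γ) L n) x * partialP i0 φ x * (pinnedChain ω₂ lam β γ).gibbsDensity L T x) +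
        ((0 : ℝ) + ∫ x, u x * partialP iR (chi (pinnedChain ω₂ lam β γ) L n) x * partialP iR φ x * (pinnedChain ω₂ lam β γ).gibbsDensity L T x)) +
        2 * ∫ x, chi (pinnedChain ω₂ lam β γ) L n x * χ x * W x * (pinnedChain ω₂ lam β γ).gibbsDensity L T x =
      -∫ x, chi (pinnedChain ω₂ lam β γ) L n x * u x * u x * (pinnedChain ω₂ lam β γ).gibbsDensity L T x := by
    intro n
    rw [← hlevel n, sum_bathWeight_mul' _ (b₀ := i0) (b₁ := iR) rfl rfl]
    have e0 : ∫ x, chi (pinnedChain ω₂ lam β γ) L n x * partialP i0 u x * partialP i0 φ x * (pinnedChain ω₂ lam β γ).gibbsDensity L T x =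
        ∫ x, chi (pinnedChain ω₂ lam β γ) L n x * (2 * x.2 i0) * partialP i0 φ x * (pinnedChain ω₂ lam β γ).gibbsDensity L T x :=
      integral_congr_ae (ae_of_all _ fun x => by dsimp only; rw [hdu0 x])
    have eR : ∫ x, chi (pinnedChain ω₂ lam β γ) L n x * partialP iR u x * partialP iR φ x * (pinnedChain ω₂ lam β γ).gibbsDensity L T x = 0 := by
      rw [← integral_zero]
      exact integral_congr_ae (ae_of_all _ fun x => by dsimp only; rw [hduR x]; ring)
    rw [e0, eR]
    ring
  -- limits
  have hp2 : ∀ i : Fin L, MemLp (fun x : PhaseSpace L => x.2 i) 2 ((pinnedChain ω₂ lam β γ).gibbsMeasure L T) :=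
    fun i => memLp_momentum hω hl hβ L hT i
  have hu2m : MemLp u 2 ((pinnedChain ω₂ lam β γ).gibbsMeasure L T) := by
    simpa only [hu] using memLp_kinetic hω hl hβ L hT i0
  have hW2 : MemLp W 2 ((pinnedChain ω₂ lam β γ).gibbsMeasure L T) := memLp_momentum_mul_partialQ_hamiltonian hω hl hβ hT L i0
  have hlimA : Tendsto (fun n : ℕ => ∫ x, chi (pinnedChain ω₂ lam β γ) L n x * (2 * x.2 i0) * partialP i0 φ x *
      (pinnedChain ω₂ lam β γ).gibbsDensity L T x) atTop (𝓝 (∫ x, (2 * x.2 i0) * partialP i0 φ x * (pinnedChain ω₂ lam β γ).gibbsDensity L T x)) := by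
    have hF : Integrable fun x => (2 * x.2 i0) * partialP i0 φ x * (pinnedChain ω₂ lam β γ).gibbsDensity L T x :=
      integrable_mul_mul_gibbsDensity hω hl hβ γ L hT ((hp2 i0).const_mul 2) hφ0
    refine (tendsto_integral_chi_mul hω.le hl hβ γ L T (F := fun x => (2 * x.2 i0) * partialP i0 φ x)
      (by fun_prop) hF).congr fun n => ?_
    exact integral_congr_ae (ae_of_all _ fun x => by ring)
  have hlimB : ∀ {i : Fin L}, MemLp (partialP i φ) 2 ((pinnedChain ω₂ lam β γ).gibbsMeasure L T) →
      Tendsto (fun n : ℕ => ∫ x, u x * partialP i (chi (pinnedChain ω₂ lam β γ) L n) x * partialP i φ x *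
        (pinnedChain ω₂ lam β γ).gibbsDensity L T x) atTop (𝓝 0) := by
    intro i hi
    have hF : Integrable fun x => u x * partialP i φ x * (pinnedChain ω₂ lam β γ).gibbsDensity L T x :=
      integrable_mul_mul_gibbsDensity hω hl hβ γ L hT hu2m hi
    refine (tendsto_integral_partialP_chi_mul hω hl hβ γ L T i (F := fun x => u x * partialP i φ x)
      (by fun_prop) hF).congr fun n => ?_
    exact integral_congr_ae (ae_of_all _ fun x => by ring)
  have hlimW : Tendsto (fun n : ℕ => ∫ x, chi (pinnedChain ω₂ lam β γ) L n x * χ x * W x * (pinnedChain ω₂ lam β γ).gibbsDensity L T x) atTop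
      (𝓝 (∫ x, χ x * W x * (pinnedChain ω₂ lam β γ).gibbsDensity L T x)) := by
    have hF : Integrable fun x => χ x * W x * (pinnedChain ω₂ lam β γ).gibbsDensity L T x :=
      integrable_mul_mul_gibbsDensity hω hl hβ γ L hT hχ2 hW2
    refine (tendsto_integral_chi_mul hω.le hl hβ γ L T (F := fun x => χ x * W x) (by fun_prop) hF).congr
      fun n => ?_
    exact integral_congr_ae (ae_of_all _ fun x => by ring)
  -- limit of the squared source: ∫ (p_0² − T)² ρ = 2T² ∫ρ
  have hsq : ∫ x, u x * u x * (pinnedChain ω₂ lam β γ).gibbsDensity L T x = 2 * T ^ 2 * ∫ x, (pinnedChain ω₂ lam β γ).gibbsDensity L T x := by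
    have hdu2 : MemLp (partialP i0 u) 2 ((pinnedChain ω₂ lam β γ).gibbsMeasure L T) := by
      have : partialP i0 u = fun x => 2 * x.2 i0 := funext hdu0
      rw [this]; exact (hp2 i0).const_mul 2
    have h := gauss_ibp hω hl hβ L hT i0 hu1 hu2m hdu2
    have e1 : ∫ x, (x.2 i0 ^ 2 - T) * u x * (pinnedChain ω₂ lam β γ).gibbsDensity L T x = ∫ x, u x * u x * (pinnedChain ω₂ lam β γ).gibbsDensity L T x :=
      integral_congr_ae (ae_of_all _ fun x => by simp only [hu])
    have e2 : ∫ x, x.2 i0 * partialP i0 u x * (pinnedChain ω₂ lam β γ).gibbsDensity L T x =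
        2 * ∫ x, x.2 i0 ^ 2 * (pinnedChain ω₂ lam β γ).gibbsDensity L T x := by
      rw [← integral_const_mul]
      exact integral_congr_ae (ae_of_all _ fun x => by dsimp only; rw [hdu0 x]; ring)
    rw [← e1, h, e2, integral_sq_mul_gibbsDensity_eq (γ := γ) hω hl hβ L hT i0]
    ring
  have hlimS : Tendsto (fun n : ℕ => ∫ x, chi (pinnedChain ω₂ lam β γ) L n x * u x * u x * (pinnedChain ω₂ lam β γ).gibbsDensity L T x) atTop
      (𝓝 (2 * T ^ 2 * ∫ x, (pinnedChain ω₂ lam β γ).gibbsDensity L T x)) := by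
    have hF : Integrable fun x => u x * u x * (pinnedChain ω₂ lam β γ).gibbsDensity L T x :=
      integrable_mul_mul_gibbsDensity hω hl hβ γ L hT hu2m hu2m
    have h := tendsto_integral_chi_mul hω.le hl hβ γ L T (F := fun x => u x * u x) (by fun_prop) hF
    rw [hsq] at h
    refine h.congr fun n => integral_congr_ae (ae_of_all _ fun x => by ring)
  have hLHS : Tendsto (fun n : ℕ =>
      -(γ * T) * (((∫ x, chi (pinnedChain ω₂ lam β γ) L n x * (2 * x.2 i0) * partialP i0 φ x * (pinnedChain ω₂ lam β γ).gibbsDensity L T x) +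
          ∫ x, u x * partialP i0 (chi (pinnedChain ω₂ lam β γ) L n) x * partialP i0 φ x * (pinnedChain ω₂ lam β γ).gibbsDensity L T x) +
        ((0 : ℝ) + ∫ x, u x * partialP iR (chi (pinnedChain ω₂ lam β γ) L n) x * partialP iR φ x * (pinnedChain ω₂ lam β γ).gibbsDensity L T x)) +
        2 * ∫ x, chi (pinnedChain ω₂ lam β γ) L n x * χ x * W x * (pinnedChain ω₂ lam β γ).gibbsDensity L T x) atTop
      (𝓝 (-(γ * T) * (((∫ x, (2 * x.2 i0) * partialP i0 φ x * (pinnedChain ω₂ lam β γ).gibbsDensity L T x) + 0) + ((0 : ℝ) + 0)) +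
        2 * ∫ x, χ x * W x * (pinnedChain ω₂ lam β γ).gibbsDensity L T x)) :=
    (((hlimA.add (hlimB hφ0)).add (tendsto_const_nhds.add (hlimB hφR))).const_mul _).add
      (hlimW.const_mul 2)
  have heq := tendsto_nhds_unique (hLHS.congr hlevel') hlimS.neg
  simp only [add_zero] at heq
  have e3 : ∫ x, (2 * x.2 i0) * partialP i0 φ x * (pinnedChain ω₂ lam β γ).gibbsDensity L T x =
      2 * ∫ x, x.2 i0 * partialP i0 φ x * (pinnedChain ω₂ lam β γ).gibbsDensity L T x := by
    rw [← integral_const_mul]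
    exact integral_congr_ae (ae_of_all _ fun x => by ring)
  have e4 : ∫ x, χ x * W x * (pinnedChain ω₂ lam β γ).gibbsDensity L T x =
      ∫ x, χ x * (x.2 i0 * partialQ i0 ((pinnedChain ω₂ lam β γ).hamiltonian L) x) * (pinnedChain ω₂ lam β γ).gibbsDensity L T x := rfl
  rw [e3] at heq
  rw [← e4]
  linarith

/-- **Pairing identity with the source.**  For `L ≥ 2` and every admissible pair `(φ, χ)` with `χ ∈ L²(μ_T)`:
`γ T ⟨p_0, ∂_{p_0}φ⟩_{μ_T} − ⟨χ, p_0 ∂_{q_0}H⟩_{μ_T} = T²`. [folklore] -/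
theorem certificate_pairing_source (hω : 0 < ω₂) (hl : 0 ≤ lam) (hβ : 0 ≤ β) (hT : 0 < T)
    {L : ℕ} (hL : 2 ≤ L) {φ χ : PhaseSpace L → ℝ} (hφ : ContDiff ℝ 2 φ) (hχ : ContDiff ℝ 2 χ)
    (hφ0 : MemLp (partialP (⟨0, by omega⟩ : Fin L) φ) 2 ((pinnedChain ω₂ lam β γ).gibbsMeasure L T))
    (hφR : MemLp (partialP (⟨L - 1, by omega⟩ : Fin L) φ) 2 ((pinnedChain ω₂ lam β γ).gibbsMeasure L T))
    (hχ2 : MemLp χ 2 ((pinnedChain ω₂ lam β γ).gibbsMeasure L T))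
    (hpair : ∀ x, γ * bathOp L (OscillatorChain.bathWeight L) T φ x +
      liouvilleOp (pinnedChain ω₂ lam β γ) L χ x = -(kin L 0 x - T)) :
    γ * T * (∫ x, x.2 ⟨0, by omega⟩ * partialP (⟨0, by omega⟩ : Fin L) φ x ∂((pinnedChain ω₂ lam β γ).gibbsMeasure L T)) -
      ∫ x, χ x * (x.2 ⟨0, by omega⟩ * partialQ (⟨0, by omega⟩ : Fin L) ((pinnedChain ω₂ lam β γ).hamiltonian L) x)
        ∂((pinnedChain ω₂ lam β γ).gibbsMeasure L T) = T ^ 2 := by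
  have h := certificate_pairing_source_density hω hl hβ hT hL hφ hχ hφ0 hφR hχ2 hpair
  have hZ : 0 < ∫ x, (pinnedChain ω₂ lam β γ).gibbsDensity L T x :=
    integral_exp_pos (pinnedChain_integrable_gibbsDensity hω hl hβ γ L hT)
  set A := ∫ x, x.2 ⟨0, by omega⟩ * partialP (⟨0, by omega⟩ : Fin L) φ x * (pinnedChain ω₂ lam β γ).gibbsDensity L T x with hA
  set Wχ := ∫ x, χ x * (x.2 ⟨0, by omega⟩ * partialQ (⟨0, by omega⟩ : Fin L) ((pinnedChain ω₂ lam β γ).hamiltonian L) x) *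
    (pinnedChain ω₂ lam β γ).gibbsDensity L T x with hWχ
  set Z := ∫ x, (pinnedChain ω₂ lam β γ).gibbsDensity L T x with hZdef
  rw [OscillatorChain.integral_gibbsMeasure, OscillatorChain.integral_gibbsMeasure]
  calc γ * T * (Z⁻¹ * A) - Z⁻¹ * Wχ = Z⁻¹ * (γ * T * A - Wχ) := by ring
    _ = Z⁻¹ * (T ^ 2 * Z) := by rw [h]
    _ = T ^ 2 := by field_simp

/-- Registered helper sub-goal `helper_certificatePairingSource` of stub `stub_transmissionGradientFloor`
(= `certificate_pairing_source` in closed form; line ForecastSensitivitySketch, crux stmt-AtomisticToContinuum-11749). [folklore] -/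
theorem helper_certificatePairingSource : ∀ {ω₂ lam β γ T : ℝ}, 0 < ω₂ → 0 ≤ lam → 0 ≤ β → 0 < T → ∀ {L : ℕ} (hL : 2 ≤ L) {φ χ : PhaseSpace L → ℝ}, ContDiff ℝ 2 φ → ContDiff ℝ 2 χ → MemLp (partialP (⟨0, by omega⟩ : Fin L) φ) 2 ((pinnedChain ω₂ lam β γ).gibbsMeasure L T) → MemLp (partialP (⟨L - 1, by omega⟩ : Fin L) φ) 2 ((pinnedChain ω₂ lam β γ).gibbsMeasure L T) → MemLp χ 2 ((pinnedChain ω₂ lam β γ).gibbsMeasure L T) → (∀ x, γ * bathOp L (OscillatorChain.bathWeight L) T φ x + liouvilleOp (pinnedChain ω₂ lam β γ) L χ x = -(kin L 0 x - T)) → γ * T * (∫ x, x.2 ⟨0, by omega⟩ * partialP (⟨0, by omega⟩ : Fin L) φ x ∂((pinnedChain ω₂ lam β γ).gibbsMeasure L T)) - ∫ x, χ x * (x.2 ⟨0, by omega⟩ * partialQ (⟨0, by omega⟩ : Fin L) ((pinnedChain ω₂ lam β γ).hamiltonian L) x) ∂((pinnedChain ω₂ lam β γ).gibbsMeasure L T)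 = T ^ 2 :=
  @certificate_pairing_source

end Summit.AtomisticToContinuum.FouriersLaw.Cruxes.ConductanceLowerBound.ForecastSensitivity

end
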